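import Mathlib
import HarnessLib
import Literature.NumberTheory.LFunctions.ZetaScrew
import Summits.RiemannHypothesis.RiemannHypothesis.Theorems.IntegerScrewPivotUpperBound
import Summits.RiemannHypothesis.RiemannHypothesis.Theorems.IntegerScrewIncrementSecondOrder
import Summits.RiemannHypothesis.RiemannHypothesis.Theorems.IntegerScrewRung128

/-!
# Route `IntegerScrew` — the pivot law's DERIVED part as ONE inequality, to second order:
# `M·d_M ≤ log M − c₀ + (log M + 5/2 − c₀)/(2M) + (2 log M + 16)/M²`

PIVOT-LAW §10.1 reads `m·d_m = L(m) − G(m)`, `G ≥ 0`, with `L(M) = M·2Ψ(log(M/(M−1)))`.  Combining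
the variational bound `d_M ≤ 2Ψ(log(M/(M−1)))` (`IntegerScrewPivotUpperBound`, valid whenever
`S_{M−1} ≻ 0`) with the second-order expansion of `L` (`IntegerScrewIncrementSecondOrder`) gives the
explicit ceiling below (`c₀ = log 2π + γ₀ − 1`): unconditionally for `3 ≤ M ≤ 129` (kernel rungs
`S_n ≻ 0`, `n ≤ 127`, `IntegerScrewRung128`), along any certified pivot ladder, and for every `M ≥ 3`
under RH.  RH-FREE statements except the last, which is RH-conditional exactly as `S_M ≻ 0` is;
nothing here bears on the truth of RH. [Suzuki2023, (1.1)]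
-/

noncomputable section

-- D-0017: `Summit.<S>.<S>.…` is the designed namespace of a single-problem summit.
set_option linter.dupNamespace false

namespace Summit.RiemannHypothesis.RiemannHypothesis.Theorems.IntegerScrew

open Literature.NumberTheory.LFunctions

/-- **`M·d_M ≤ log M − c₀ + (log M + 5/2 − c₀)/(2M) + (2 log M + 16)/M²` for every `M ≥ 3` at which
`S_{M−1} = screwMatrix (M − 2)` is positive definite.** [folklore] -/
theorem mul_screwPivot_le_secondOrderCeiling (M : ℕ) (hM : 3 ≤ M)
    (h : (screwMatrix (M - 2)).PosDef) :
    (M : ℝ) * screwPivot M ≤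
      (Real.log M - (Real.log (2 * Real.pi) + Real.eulerMascheroniConstant - 1)
        + (Real.log M + 5 / 2 - (Real.log (2 * Real.pi) + Real.eulerMascheroniConstant - 1))
            / (2 * (M : ℝ))
        + (2 * Real.log M + 16) / (M : ℝ) ^ 2) := by
  have hM0 : (0 : ℝ) ≤ (M : ℝ) := Nat.cast_nonneg M
  have h1 := screwPivot_le_two_zetaScrew_log_div M (by omega) h
  have h2 := abs_incrementEnergy_sub_secondOrder_le M hM
  have h3 : (M : ℝ) * screwPivot M ≤
      (M : ℝ) * (2 * zetaScrew (Real.log ((M : ℝ) / ((M : ℝ) - 1)))) :=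
    mul_le_mul_of_nonneg_left h1 hM0
  rw [abs_le] at h2
  linarith [h2.2]

/-- RH-FREE RANGE: the ceiling holds unconditionally for `3 ≤ M ≤ 129` (kernel rungs `S_n ≻ 0` for
`n ≤ 127`, `IntegerScrewRung128.screwMatrix_posDef_of_le_127`). [folklore] -/
theorem mul_screwPivot_le_secondOrderCeiling_of_le (M : ℕ) (hM : 3 ≤ M) (hM' : M ≤ 129) :
    (M : ℝ) * screwPivot M ≤
      (Real.log M - (Real.log (2 * Real.pi) + Real.eulerMascheroniConstant - 1)
        + (Real.log M + 5 / 2 - (Real.log (2 * Real.pi) + Real.eulerMascheroniConstant - 1))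
            / (2 * (M : ℝ))
        + (2 * Real.log M + 16) / (M : ℝ) ^ 2) :=
  mul_screwPivot_le_secondOrderCeiling M hM (screwMatrix_posDef_of_le_127 (by omega))

/-- ALONG A CERTIFIED LADDER: if `d_2, …, d_{N+1} > 0` then the ceiling holds for every
`3 ≤ M ≤ N + 2` (including the next rung). [folklore] -/
theorem mul_screwPivot_le_secondOrderCeiling_of_ladder (N : ℕ)
    (hlad : ∀ M : ℕ, 2 ≤ M → M ≤ N + 1 → 0 < screwPivot M) (M : ℕ) (hM : 3 ≤ M)
    (hMN : M ≤ N + 2) :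
    (M : ℝ) * screwPivot M ≤
      (Real.log M - (Real.log (2 * Real.pi) + Real.eulerMascheroniConstant - 1)
        + (Real.log M + 5 / 2 - (Real.log (2 * Real.pi) + Real.eulerMascheroniConstant - 1))
            / (2 * (M : ℝ))
        + (2 * Real.log M + 16) / (M : ℝ) ^ 2) :=
  mul_screwPivot_le_secondOrderCeiling M hM
    (screwMatrix_posDef_of_screwPivot_pos_le N hlad (M - 2) (by omega))

/-- UNDER RH, for every `M ≥ 3`: `0 < M·d_M ≤` the second-order ceiling. [folklore] -/
theorem mul_screwPivot_le_secondOrderCeiling_of_riemannHypothesis (hRH : _root_.RiemannHypothesis)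
    (M : ℕ) (hM : 3 ≤ M) :
    0 < (M : ℝ) * screwPivot M ∧ (M : ℝ) * screwPivot M ≤
      (Real.log M - (Real.log (2 * Real.pi) + Real.eulerMascheroniConstant - 1)
        + (Real.log M + 5 / 2 - (Real.log (2 * Real.pi) + Real.eulerMascheroniConstant - 1))
            / (2 * (M : ℝ))
        + (2 * Real.log M + 16) / (M : ℝ) ^ 2) := by
  have hpos := (screwPivot_le_two_zetaScrew_log_div_of_riemannHypothesis hRH M (by omega)).1
  have hM0 : (0 : ℝ) < (M : ℝ) := by exact_mod_cast (by omega : 0 < M)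
  exact ⟨mul_pos hM0 hpos,
    mul_screwPivot_le_secondOrderCeiling M hM (screwMatrix_posDef_of_riemannHypothesis hRH (M - 2))⟩

end Summit.RiemannHypothesis.RiemannHypothesis.Theorems.IntegerScrew
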